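import Summits.ResolutionOfSingularities.ResolutionOfSingularities.Theses.FrobeniusLadder
import Summits.ResolutionOfSingularities.ResolutionOfSingularities.Theorems.FrobeniusLadderFInjectiveMacaulayficationIntrinsicTowerRecipes
import HarnessLib

/-!
# Crux `FInjectiveMacaulayfication` (stmt-ResolutionOfSingularities-15315) — LINE v42 «INTRINSIC-CENTRE» (BY EVIDENCE ONLY; v41 `Lines/step_door.lean` STAYS THE REGISTERED SKELETON)
# (res-L1-w45a-plan-1 RULINGS R19.2 (4) / R19.4 (3d) / R19.5 (2) «v42 GUARD»: registered by lead-1 BY EVIDENCE with `stub_tauTowerConjecture : …IntrinsicTower.Recipes.TauTowerConjecture`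
# — NOT the N-recipe `IntrinsicTowerConjecture`, which our own computations contest — once the Recipes file is ✓ and V-READ; text by res-L1-w45a-lead-1 g9 over res-L1-w45a-stub-2's
# `…IntrinsicTowerRecipes` (desk v2 `L/w45a/TauTowerSig.lean` 1c471f18f0788d50) and lead-1's `…FullCentreDescent` / `…FullCentreDescentRegular`)

[OURS · L1 W4.5a] Line file in skeleton shape (ZERO-binder theorems only; sorries ONLY in the three `stub_*`; the deciding theorem `FInjectiveMacaulayfication_of` (alias
`FInjectiveMacaulayfication_proof`) concludes the route decl BY NAME). NOT registered with `ledger skeleton check`: per R18.7 / R19.5 (2) a skeleton is replaced only by a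
kernel-WEAKER or better-EVIDENCED residue, and (TT-τ) is kernel-STRONGER than v41's F-half. AI-written (AI review is weaker than expert review).

THE LINE. Door v41's residue is {four printed theorems, the F-half `LocalFInjectivizationFibreAdmGe4` (CM ⇒ FULL by one fibre-supported blowing up, fibre-locally, d ≥ 4), the
T-half T″(p,e,1)}. The F-half is an ∃-statement no computation can refute. v42 replaces it by ONE CANONICAL PROCESS: «from every admissible Cohen–Macaulay first floor S′, blow up
the reduced closure of the (non-F-regular ∪ non-FULL) singular locus (the rad-τ centre `tauCentre`), floor by floor; after finitely many floors the scheme is FULL at every point»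
(`IntrinsicTower.Recipes.TauTowerConjecture := TowerTerminates tauCentre`). KERNEL BRIDGE (✓, unconditional, recipe-parametric): Lemma A-REG
`FullCentreDescent.exists_fullCentre_of_tower_of_regularOff` (lead-1) ⇒ `IntrinsicTower.Recipes.exists_fibreCentre_of_towerFull` ⇒
`IntrinsicTower.Recipes.localFInjectivizationFibreAdmGe4_of_towerTerminates tauCentre singSupported_tauCentre : TauTowerConjecture → F-half` (stub-2) ⇒ door term
`fInjectiveMacaulayfication_of_prints_of_tauTower_of_tStepOne`. VALUE: every open stub of this line except the prints is REFUTABLE BY ONE COMPUTATION — a single admissible floor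
whose rad-τ tower provably loops kills `stub_tauTowerConjecture` (kernel shape: `FullCentreDescent.not_exists_tower_of_persistent`), and T″ instances are being typed (E4″@G).
EVIDENCE (res-L1-w45a-idea-1 FB5-r4/FB5-r5, res-L1-w45a-tri-2 kit batches; evidence-level, OURS): every rad-τ tower of the p = 2, d = 4 bed terminates (16/16 ≤ 6 floors from the
τ-floor, point-first rows likewise); the N-recipe variant (`IntrinsicTower.IntrinsicTowerConjecture` ≡ `Recipes.NonFullTowerConjecture`) is REFUTED BY EVIDENCE (plan-1 R19.7, idea-1 FB5-r6: from the point floor of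
P2d4B an ESCALATOR `G_k = e² + abᵏde + abd²(1+c³) + a³`, floor 3m+5 carries `G_{m+2}`, never FULL; kernel decls stay `@[conjecture]`-tagged, no kernel refutation commissioned)
— hence the guard above; the rad-τ recipe purifies the same floors (P2d4B FULL at floor 5) and is SUPPORTED on 21/21 specimens / 98 runs (TT-τ table v1). FIRST KERNEL TOWER INSTANCE:
`IntrinsicTower.InstanceTauFloorP2d4C.towerFull_one` (N-recipe, τ-floor chart of P2d4C; stub-2 p632182).
HONEST CAVEATS: (TT-τ) is kernel-STRONGER than the F-half (so v41 remains the line of record); it quantifies over EVERY admissible first floor including `Spec 𝒪_{X,x}` itself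
(I = ⊤), by design; `tauCentre` is typed over an instance-free test ideal `testIdeal'` (idea-1 Sketch r21 §2b) whose values on bed charts are NOT yet identified in the kernel
(deferred: idea-1 (B4″)); open for every d ≥ 4; FULL ⊋ F-rational; nothing of the crux is proved. KILL TEST: `stub_tauTowerConjecture` — K-TT-a (a provably looping rad-τ tower at
one admissible floor) kills THIS LINE ONLY; K4.5 ALIVE.
-/

-- single-problem summit: the doubled namespace component is forced
set_option linter.dupNamespace false

noncomputable section

namespace Summit.ResolutionOfSingularities.ResolutionOfSingularities.Cruxes.FInjectiveMacaulayfication.IntrinsicCentre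

open AlgebraicGeometry CategoryTheory Literature.AlgebraicGeometry.Resolution

/-- NAMED FACTS BY NAME (the ONE named-fact stub, NEVER a prover target; byte-identical to v38/v39-FL/v40/v41): Cossart–Piltant 2019 Thm 1.1 (`CossartPiltant2019General`) ·
Raynaud–Gruson flattening = Stacks 081R (`Stacks081R`) · Cossart–Piltant 2019 Prop 4.4 (`CossartPiltant2019Principalization`) · Česnavičius 2021 Thm 5.3 reading (B)
(`CesnaviciusBlowupMacaulayficationOffClosed`, Literature p602953). [cite: CossartPiltant2019, Thm. 1.1; Prop. 4.4] [cite: StacksProject, Tag 081R] [cite: Cesnavicius2021, Thm. 5.3] -/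
theorem stub_namedFacts :
    Literature.AlgebraicGeometry.Resolution.CossartPiltant2019General.{0} ∧ Literature.AlgebraicGeometry.Resolution.Stacks081R.{0} ∧ Literature.AlgebraicGeometry.Resolution.CossartPiltant2019Principalization.{0} ∧
      Literature.AlgebraicGeometry.Resolution.CesnaviciusBlowupMacaulayficationOffClosed.{0} := by
  sorry

/-- STUB (T″) — **THE «FULL ⇒ REGULAR» FIBRE-LOCAL STEP AT FULL GERMS OF `e`-FOLDS OVER `k(s)`, `e ≥ 4`** (`TrFullStep.LocalRegularizationFibreFullTr p e 1` BY NAME, res-L1-w45a-stub-3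
p618253; byte-identical to v41's stub): at a closed singular point with FULL local ring of an integral separated finite-type `e`-fold over `K := FractionRing (MvPolynomial (Fin 1) k)`,
every FULL admissible modification regular off the closed fibre admits a fibre-supported centre `𝓚 ≠ ⊥` all of whose blowings up are REGULAR. Open for every `e ≥ 4`; one
evidence-level instance (E4″@G, res-L1-w45a-stub-1, -2, -3, kernel row in flight). [conjecture · OURS · v41/v42 stub] -/
theorem stub_localRegularizationFibreFullTr :
    ∀ p e : ℕ, p.Prime → 4 ≤ e →
      Summit.ResolutionOfSingularities.ResolutionOfSingularities.Theorems.FInjectiveMacaulayfication.TrFullStep.LocalRegularizationFibreFullTr p e 1 := by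
  sorry

/-- STUB (TT-τ) — **THE rad-τ INTRINSIC TOWER TERMINATES** (`IntrinsicTower.Recipes.TauTowerConjecture := TowerTerminates tauCentre` BY NAME, res-L1-w45a-stub-2 over the desk's v2
signature): with the F-half's binders VERBATIM (closed singular `x`, `dim 𝒪_{X,x} = d ≥ 4`, an admissible blowing up `S′ → Spec 𝒪_{X,x}` along `I ≠ ⊥`, `supp I ⊆ (Reg)ᶜ`, regular
off the closed fibre, Cohen–Macaulay at every point), SOME height `n` of the tower «blow up `tauCentre` = the reduced ideal sheaf of the closure of the (non-F-regular ∪ non-FULL)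
singular locus, repeat» starting at `S′` ends FULL at every point. KILLABLE by one admissible floor whose rad-τ tower provably loops or never purifies
(`FullCentreDescent.not_exists_tower_of_persistent`). Evidence: every rad-τ tower of the p = 2, d = 4 bed terminates (idea-1 FB5-r4/r5; tri-2 batches). Implies the F-half
(`IntrinsicTower.Recipes.localFInjectivizationFibreAdmGe4_of_towerTerminates tauCentre singSupported_tauCentre`); NOT implied by it. [conjecture · OURS · v42 stub] -/
theorem stub_tauTowerConjecture :
    Summit.ResolutionOfSingularities.ResolutionOfSingularities.Theorems.FInjectiveMacaulayfication.IntrinsicTower.Recipes.TauTowerConjecture := by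
  sorry

/-- **THE DECIDING THEOREM (v42, intrinsic-centre line)**: the crux `FInjectiveMacaulayfication` BY NAME from the named bundle, (TT-τ) and T″ at `r = 1`, by res-L1-w45a-stub-2's
`IntrinsicTower.Recipes.fInjectiveMacaulayfication_of_prints_of_tauTower_of_tStepOne` (= v41's `TrFullStepDoor` term with the F-half supplied by Lemma A-REG + (TT-τ)). [OURS assembly; v42] -/
theorem FInjectiveMacaulayfication_of :
    Summit.ResolutionOfSingularities.ResolutionOfSingularities.Theses.FrobeniusLadder.FInjectiveMacaulayfication :=
  Summit.ResolutionOfSingularities.ResolutionOfSingularities.Theorems.FInjectiveMacaulayfication.IntrinsicTower.Recipes.fInjectiveMacaulayfication_of_prints_of_tauTower_of_tStepOne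
    stub_namedFacts.1 stub_namedFacts.2.1 stub_namedFacts.2.2.1 stub_namedFacts.2.2.2
    stub_tauTowerConjecture stub_localRegularizationFibreFullTr

/-- The same deciding term under v38's name convention. [OURS assembly; v42] -/
theorem FInjectiveMacaulayfication_proof :
    Summit.ResolutionOfSingularities.ResolutionOfSingularities.Theses.FrobeniusLadder.FInjectiveMacaulayfication :=
  FInjectiveMacaulayfication_of

end Summit.ResolutionOfSingularities.ResolutionOfSingularities.Cruxes.FInjectiveMacaulayfication.IntrinsicCentre

end
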